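import Summits.ResolutionOfSingularities.ResolutionOfSingularities.Theorems.TwistCutElimination
import Literature.AlgebraicGeometry.Resolution.OrderSemicontinuity
import Literature.AlgebraicGeometry.Resolution.BlowupRestrictOpen
import Literature.AlgebraicGeometry.Resolution.CanonicalResolutionProofs
import HarnessLib

/-!
# TwistCutOrderUSC — decomp-res node «TwistCut» rev3 (lens-6 g21), tree file 5/5 of the node

Content VERBATIM from the decomp-res lens-6 g21 rev3 node file `HOME/decomp-res-lens-6/g21/TwistCutFinal.lean` (sha
a36321ac, 1 327 l;
HOME = run/shared/lean/pub/decomp-res; rc 0 · 0 sorry · standard axioms; nested prefixes `TwistCut.lean` facffb9d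
(ll. 1–779, in the tree as
`TwistCutOperators` · `TwistCutLaw` · `TwistCutCells`) ⊂ `TwistCutElim.lean` 868dfb91 (§10–§11) ⊂ `TwistCutUSC.lean`
c2aec299 (§12) ⊂ this file
(§13) — machine diffs = pure insertions; earlier parts imported, not repeated): its §10–§13 ONLY, as two tree files.
 Critic: CRITIC-LEDGER rows 161
(rev1 MAP +1: the elimination induction) / 161a (rev2, 0·0 hygiene: `WildSplitFinite` from `OrderUSC`); landing
orders INBOX :605 / :622, package
NODE-g21-rev3.md ca6f9cc7 §3 (`TwistCutElimination` §10–§12 + `TwistCutOrderUSC` §13; here §12 rides with §13 only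
to respect the 400-line file cap).

## This file

§12 FINITENESS OF THE SPLIT WILD SET from upper semicontinuity of the order (`OrderUSC`: `IsClosed {x | n ≤ ord}` on
`IsBase` schemes;
`eq_singleton_of_isIrreducible` = isolation of split wild points via generic-point lift + properness + the twist
law; `wildSplitFinite_of_orderUSC`;
`e1TopNoAbs_iff_e1TopNonSplit_of_orderUSC`) and §13 THE PORT `OrderUSC` DISCHARGED (**`orderUSC_holds`**:
irreducible open cover, integral J-2 case =
tree `isClosed_setOf_le_idealOrder_of_isJ2`, `isJ2Ring_of_finiteType_field`, `idealOrder_comap_of_isOpenImmersion`);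
consequences
`worTopOnlySplit_of_baseStable`, **`e1TopNoAbs_iff_e1TopNonSplit_of_baseStable : BaseStable → SubfieldContactAbs → E
5 → (E1TopNoAbs ↔ E1TopNonSplit)`**,
`e_one_of_nonSplit_of_baseStable`.  After this file the decided side of the twist cell is decided MODULO THE COSTUME
`BaseStable` ONLY.  Cone-free.
Imports `TwistCutElimination` + Literature `OrderSemicontinuity` / `BlowupRestrictOpen` / `CanonicalResolutionProofs`.

[WRITER NOTE (decomp-res writer g9): one tree file (≤ 400 lines); namespace, universe, sections, section variables /
opens and every declaration
exactly as in the lens.]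

(Sources: EGAIV4 16.8.2, 16.8.8; Matsumura1987 §26, Thm 30.6; BGMW §3.1; CossartJannsenSaito2020 Def. 3.13, §4;
CossartPiltant2008 Prop. 4.2; CossartPiltant2019; GortzWedhorn2020 Prop. 13.91/13.96; Giraud1975;
Hironaka1970Additive; Liu2002 §8.1.)
-/

noncomputable section

open CategoryTheory AlgebraicGeometry TopologicalSpace IsLocalRing
open Literature.AlgebraicGeometry.Resolution

universe u

namespace Summit.ResolutionOfSingularities.ResolutionOfSingularities.Theorems.TwistCutClasses

section Finiteness

open Summit.ResolutionOfSingularities.ResolutionOfSingularities.Theorems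
open WeakOrderReduction ForcedTowerClasses SubfieldContactClasses AbsoluteContactClasses PurityValveClasses
open Scheme.IdealSheafData (vanishingIdeal)

/-! ## §12 FINITENESS OF THE SPLIT WILD SET from upper semicontinuity of the order (port `OrderUSC`) -/

/-- **port · `OrderUSC`** (KNOWN-MOD-PORT): UPPER SEMICONTINUITY OF THE ORDER on base schemes — for a regular scheme `Y`
separated of finite type over a field and any ideal sheaf `I`, every `{y | n ≤ ord_y I}` is closed.  In print: Cutkosky 2004
Thm. A.19; Cossart–Jannsen–Saito; CossartPiltant2008 Prop. 4.2 (proof).  Tree: `isClosed_setOf_le_idealOrder`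
(integral excellent
case). -/
def OrderUSC : Prop :=
  ∀ (k : Type) [Field k] (Y : Scheme.{0}) (g : Y ⟶ Spec (.of k)), IsBase Y g →
    ∀ (I : Y.IdealSheafData) (n : ℕ), IsClosed {y : Y | ((n : ℕ) : ℕ∞) ≤ idealOrder I y}

variable {Y Y' : Scheme.{0}} {π : Y' ⟶ Y} {C : Y.IdealSheafData}

/-- A blow-up is surjective off its centre. [folklore; tree `IsBlowup.isIso_compl`] [folklore] -/
theorem exists_preimage_of_not_mem (hπ : IsBlowup π C) {y : Y} (hy : y ∉ (C.support : Set Y)) :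
    ∃ y' : Y', π.base y' = y := by
  let W₀ : Y.Opens := ⟨(C.support : Set Y)ᶜ, C.support.isClosed.isOpen_compl⟩
  haveI : IsIso (π ∣_ W₀) := hπ.isIso_compl
  have hsurj := (Scheme.homeoOfIso (asIso (π ∣_ W₀))).surjective
  rw [Scheme.coe_homeoOfIso, asIso_hom] at hsurj
  obtain ⟨x, hx⟩ := hsurj ⟨y, hy⟩
  refine ⟨x.1, ?_⟩
  have := congrArg Subtype.val hx
  rw [morphismRestrict_base_coe] at this
  exact this

/-- **ISOLATION OF SPLIT WILD POINTS** (PROVED modulo `OrderUSC` upstairs and the costume `BaseStable`): an irreducible closed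
subset of the top locus through a split closed top point is that point.  (Generic point off the centre lifts with order `n`;
the proper blow-up maps the closure of the lift onto the subset; u.s.c. upstairs puts a point of the support over the centre,
against the twist law.) [new] [folklore] -/
theorem eq_singleton_of_isIrreducible (hU : OrderUSC) (hBS : BaseStable) {k : Type} [Field k] {Y : Scheme.{0}}
    {g : Y ⟶ Spec (.of k)} (hB : IsBase Y g) {n : ℕ} (hn : 1 ≤ n) {M : MarkedIdeal Y} (hM : IsDatum n M) {y₀ : Y}
    (hy₀c : IsClosed ({y₀} : Set Y)) (hs : DiffSplitAt M.ideal n y₀) {Z : Set Y} (hZ : IsIrreducible Z)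
    (hZc : IsClosed Z) (hZT : Z ⊆ M.support) (hy₀Z : y₀ ∈ Z) : Z = {y₀} := by
  haveI := hB.locallyOfFiniteType
  haveI : IsLocallyNoetherian Y := LocallyOfFiniteType.isLocallyNoetherian g
  have hCsupp : ((vanishingIdeal ⟨{y₀}, hy₀c⟩ : Y.IdealSheafData).support : Set Y) = {y₀} :=
    coe_support_vanishingIdeal_singleton hy₀c
  have hCreg : Scheme.IsRegular (vanishingIdeal ⟨{y₀}, hy₀c⟩ : Y.IdealSheafData).subscheme :=
    isRegular_subscheme_vanishingIdeal_singleton hy₀c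
  have hπ := blowup.isBlowup (vanishingIdeal ⟨{y₀}, hy₀c⟩ : Y.IdealSheafData)
  haveI := hπ.isProper
  have hB₁ := hBS k Y g hB _ hCreg
  obtain ⟨-, hno⟩ := isDatum_transform_point hπ hB.isRegular hn hM hy₀c hCsupp hCreg hs
  by_contra hne
  have hζ : IsGenericPoint hZ.genericPoint Z := hZ.isGenericPoint_genericPoint hZc
  have hζne : hZ.genericPoint ≠ y₀ := by
    intro h
    apply hne
    rw [← hζ.def, h, hy₀c.closure_eq]
  have hζC : hZ.genericPoint ∉ ((vanishingIdeal ⟨{y₀}, hy₀c⟩ : Y.IdealSheafData).support : Set Y) := by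
    rw [hCsupp]; exact hζne
  obtain ⟨ζ', hζ'⟩ := exists_preimage_of_not_mem hπ hζC
  have hζ'C : (blowup.π (vanishingIdeal ⟨{y₀}, hy₀c⟩ : Y.IdealSheafData)).base ζ' ∉
      ((vanishingIdeal ⟨{y₀}, hy₀c⟩ : Y.IdealSheafData).support : Set Y) := by rw [hζ']; exact hζC
  -- the lift has order `n`
  have hord : ((n : ℕ) : ℕ∞) ≤ idealOrder (M.transform (blowup.π (vanishingIdeal ⟨{y₀}, hy₀c⟩ : Y.IdealSheafData))
      (vanishingIdeal ⟨{y₀}, hy₀c⟩)).ideal ζ' := by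
    rw [MarkedIdeal.transform_ideal, hπ.idealOrder_controlledTransform_of_not_mem M.ideal M.mult hζ'C, hζ', ← hM.1]
    exact hZT hζ.mem
  -- the image of the closure of the lift is closed and contains `Z`
  have hcl : IsClosed ((blowup.π (vanishingIdeal ⟨{y₀}, hy₀c⟩ : Y.IdealSheafData)).base '' closure {ζ'}) :=
    (blowup.π _).isClosedMap _ isClosed_closure
  have hZsub : Z ⊆ (blowup.π (vanishingIdeal ⟨{y₀}, hy₀c⟩ : Y.IdealSheafData)).base '' closure {ζ'} := by
    rw [← hζ.def]
    exact closure_minimal (Set.singleton_subset_iff.mpr ⟨ζ', subset_closure rfl, hζ'⟩) hcl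
  obtain ⟨y', hy'cl, hy'⟩ := hZsub hy₀Z
  -- u.s.c. upstairs
  have hT₁ := hU k _ _ hB₁ (M.transform (blowup.π (vanishingIdeal ⟨{y₀}, hy₀c⟩ : Y.IdealSheafData))
      (vanishingIdeal ⟨{y₀}, hy₀c⟩)).ideal n
  have hy'T : ((n : ℕ) : ℕ∞) ≤ idealOrder (M.transform (blowup.π (vanishingIdeal ⟨{y₀}, hy₀c⟩ : Y.IdealSheafData))
      (vanishingIdeal ⟨{y₀}, hy₀c⟩)).ideal y' :=
    (closure_minimal (t := {y | ((n : ℕ) : ℕ∞) ≤ idealOrder (M.transform (blowup.π (vanishingIdeal ⟨{y₀}, hy₀c⟩ :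
      Y.IdealSheafData)) (vanishingIdeal ⟨{y₀}, hy₀c⟩)).ideal y}) (Set.singleton_subset_iff.mpr hord) hT₁) hy'cl
  apply hno y' hy'
  show ((M.transform _ _).mult : ℕ∞) ≤ _
  rw [MarkedIdeal.transform_mult, hM.1]
  exact hy'T

/-- **`OrderUSC → BaseStable → WildSplitFinite n`** (PROVED): the split wild closed top points are among the (finitely many)
one-point irreducible closed pieces of the closed top locus of a noetherian scheme. [new] [folklore] -/
theorem wildSplitFinite_of_orderUSC (hU : OrderUSC) (hBS : BaseStable) {n : ℕ} (hn : 1 ≤ n) : WildSplitFinite n := by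
  intro k _ Y g hB M hM hsplit
  haveI := hB.locallyOfFiniteType
  haveI : IsLocallyNoetherian Y := LocallyOfFiniteType.isLocallyNoetherian g
  haveI := hB.quasiCompact
  haveI : CompactSpace Y := QuasiCompact.compactSpace_of_compactSpace g
  haveI : IsNoetherian Y := {}
  have hTc : IsClosed (M.support : Set Y) := by
    show IsClosed {x | (M.mult : ℕ∞) ≤ idealOrder M.ideal x}
    rw [hM.1]; exact hU k Y g hB M.ideal n
  obtain ⟨S, hSf, hSc, hSi, hSU⟩ := NoetherianSpace.exists_finite_set_isClosed_irreducible hTc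
  refine Set.Finite.of_finite_image (f := fun y : Y => ({y} : Set Y)) (hSf.subset ?_) Set.singleton_injective.injOn
  rintro _ ⟨y₀, hy₀, rfl⟩
  have hy₀T : y₀ ∈ M.support := by
    show (M.mult : ℕ∞) ≤ idealOrder M.ideal y₀
    rw [hM.1, hy₀.2.1]
  rw [hSU] at hy₀T
  obtain ⟨Z, hZS, hy₀Z⟩ := Set.mem_sUnion.mp hy₀T
  have hZT : Z ⊆ M.support := by rw [hSU]; exact Set.subset_sUnion_of_mem hZS
  have hZeq := eq_singleton_of_isIrreducible hU hBS hB hn hM hy₀.1 (hsplit y₀ hy₀) (hSi Z hZS) (hSc Z hZS) hZT hy₀Z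
  show ({y₀} : Set Y) ∈ S
  rw [← hZeq]; exact hZS

/-- **THE DECIDED CELL modulo the two standard ports** (PROVED): `OrderUSC → BaseStable → WORAllAbs n →
WORTopOnlySplit n`. [new] [folklore] -/
theorem worTopOnlySplit_of_orderUSC (hU : OrderUSC) (hBS : BaseStable) {n : ℕ} (hn : 1 ≤ n) (hA : WORAllAbs n) :
    WORTopOnlySplit n :=
  worTopOnlySplit_of_baseStable_of_finite hBS hn (wildSplitFinite_of_orderUSC hU hBS hn) hA

/-- **THE RE-LOCATION modulo the two standard ports**: `OrderUSC → BaseStable → SubfieldContactAbs → E 5 →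
(E1TopNoAbs ↔ E1TopNonSplit)`. [new] [folklore] -/
theorem e1TopNoAbs_iff_e1TopNonSplit_of_orderUSC (hU : OrderUSC) (hBS : BaseStable) (hSC : SubfieldContactAbs)
    (h5 : E 5) : E1TopNoAbs ↔ E1TopNonSplit :=
  e1TopNoAbs_iff_e1TopNonSplit_final hBS (fun _ hn => wildSplitFinite_of_orderUSC hU hBS hn) hSC h5

/-- **Summit edge modulo the two standard ports**: `OrderUSC → BaseStable → SubfieldContactAbs → E 5 → E1TopNonSplit
→ E 1`. [folklore] -/
theorem e_one_of_nonSplit_of_orderUSC (hU : OrderUSC) (hBS : BaseStable) (hSC : SubfieldContactAbs) (h5 : E 5)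
    (hR : E1TopNonSplit) : E 1 :=
  e_one_of_nonSplit_final hBS (fun _ hn => wildSplitFinite_of_orderUSC hU hBS hn) hSC h5 hR

end Finiteness

section USC

open Summit.ResolutionOfSingularities.ResolutionOfSingularities.Theorems
open WeakOrderReduction ForcedTowerClasses SubfieldContactClasses AbsoluteContactClasses PurityValveClasses

/-! ## §13 THE PORT `OrderUSC` DISCHARGED: u.s.c. of the order on base schemes (integral → regular passage over the tree) -/

/-- Regular schemes are reduced. [folklore] -/
theorem isReduced_of_isRegular' {S : Scheme.{0}} (h : Scheme.IsRegular S) : IsReduced S := by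
  haveI : ∀ x : S, _root_.IsReduced (S.presheaf.stalk x) := fun x => by
    haveI := h x
    haveI := isDomain_of_isRegularLocalRing (S.presheaf.stalk x)
    infer_instance
  exact isReduced_of_isReduced_stalk S

/-- Regularity restricts to open subschemes. [folklore] -/
theorem isRegular_of_isOpenImmersion' {U X : Scheme.{0}} (j : U ⟶ X) [IsOpenImmersion j]
    (h : Scheme.IsRegular X) : Scheme.IsRegular U := by
  intro x
  haveI := h (j.base x)
  exact IsRegularLocalRing.of_ringEquiv (asIso (j.stalkMap x)).commRingCatIsoToRingEquiv

/-- `ord_x(0) = ⊤`. [folklore] -/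
theorem idealOrder_bot_eq_top'' {X : Scheme.{0}} (x : X) : idealOrder (⊥ : X.IdealSheafData) x = ⊤ := by
  have hb : stalkIdeal (⊥ : X.IdealSheafData) x = ⊥ := by
    obtain ⟨U, hU, hxU, -⟩ := exists_isAffineOpen_mem_and_subset (X := X) (x := x) (U := ⊤) (Opens.mem_top _)
    rw [stalkIdeal_eq_map_germ ⊥ ⟨U, hU⟩ hxU, Scheme.IdealSheafData.ideal_bot, Pi.bot_apply, Ideal.map_bot]
  refine eq_top_iff.mpr (ENat.forall_natCast_le_iff_le.mp fun c _ => ?_)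
  rw [le_idealOrder_iff, hb]
  exact bot_le

/-- Affine opens of a scheme locally of finite type over a field have J-2 coordinate rings. [folklore; tree
`isJ2Ring_of_finiteType_field`] [folklore] -/
theorem isJ2Ring_sections_of_field {k : Type} [Field k] {X : Scheme.{0}} (f : X ⟶ Spec (.of k))
    [LocallyOfFiniteType f] (V : X.affineOpens) : IsJ2Ring Γ(X, V) := by
  have hft : RingHom.FiniteType (f.appLE ⊤ V le_top).hom :=
    HasRingHomProperty.appLE @LocallyOfFiniteType f inferInstance ⟨⊤, isAffineOpen_top _⟩ V le_top
  let φ : k →+* Γ(X, V) := (f.appLE ⊤ V le_top).hom.comp (Scheme.ΓSpecIso (.of k)).inv.hom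
  have hφ : φ.FiniteType := hft.comp (RingHom.FiniteType.of_surjective _
    (Scheme.ΓSpecIso (.of k)).symm.commRingCatIsoToRingEquiv.surjective)
  letI : Algebra k Γ(X, V) := φ.toAlgebra
  haveI : Algebra.FiniteType k Γ(X, V) := hφ
  exact isJ2Ring_of_finiteType_field k _

/-- **`OrderUSC` holds** (PROVED): upper semicontinuity of the order on regular schemes separated of finite type over a field,
from the tree's integral J-2 case `isClosed_setOf_le_idealOrder_of_isJ2` by passing to irreducible open neighbourhoods
(`Scheme.IsRegular.exists_isOpen_isIrreducible_mem`). (Sources: CossartPiltant2008, Prop. 4.2 (proof).) -/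
theorem orderUSC_holds : OrderUSC := by
  intro k _ Y g hB I n
  haveI := hB.locallyOfFiniteType
  haveI : IsLocallyNoetherian Y := LocallyOfFiniteType.isLocallyNoetherian g
  haveI := hB.quasiCompact
  haveI : CompactSpace Y := QuasiCompact.compactSpace_of_compactSpace g
  haveI : IsNoetherian Y := {}
  haveI : IsReduced Y := isReduced_of_isRegular' hB.isRegular
  choose W hWo hWirr hyW using fun y : Y => hB.isRegular.exists_isOpen_isIrreducible_mem y
  let U : Y → Y.Opens := fun y => ⟨W y, hWo y⟩
  have hU : TopologicalSpace.IsOpenCover U := by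
    rw [TopologicalSpace.IsOpenCover, eq_top_iff]
    intro y _
    exact Opens.mem_iSup.mpr ⟨y, hyW y⟩
  rw [hU.isClosed_iff_coe_preimage]
  intro y
  haveI : IrreducibleSpace (U y) := Subtype.irreducibleSpace (hWirr y)
  haveI : IsIntegral (U y : Scheme.{0}) := isIntegral_of_irreducibleSpace_of_isReduced _
  haveI : CompactSpace (U y) := isCompact_iff_compactSpace.mp (NoetherianSpace.isCompact _)
  haveI : IsNoetherian (U y : Scheme.{0}) := {}
  have hreg : Scheme.IsRegular (U y : Scheme.{0}) := isRegular_of_isOpenImmersion' (U y).ι hB.isRegular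
  have hJ2 : ∀ V : (U y : Scheme.{0}).affineOpens, IsJ2Ring Γ(U y, V) :=
    fun V => isJ2Ring_sections_of_field ((U y).ι ≫ g) V
  have hpre : (Subtype.val ⁻¹' {y' : Y | ((n : ℕ) : ℕ∞) ≤ idealOrder I y'} : Set (U y)) =
      {w : (U y : Scheme.{0}) | ((n : ℕ) : ℕ∞) ≤ idealOrder (I.comap (U y).ι) w} := by
    ext w
    simp only [Set.mem_preimage, Set.mem_setOf_eq, idealOrder_comap_of_isOpenImmersion]
    rfl
  have key : IsClosed {w : (U y : Scheme.{0}) | ((n : ℕ) : ℕ∞) ≤ idealOrder (I.comap (U y).ι) w} := by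
    by_cases hJ : I.comap (U y).ι = ⊥
    · have huniv : {w : (U y : Scheme.{0}) | ((n : ℕ) : ℕ∞) ≤ idealOrder (I.comap (U y).ι) w} = Set.univ := by
        refine Set.eq_univ_of_forall fun w => ?_
        show ((n : ℕ) : ℕ∞) ≤ idealOrder (I.comap (U y).ι) w
        rw [hJ, idealOrder_bot_eq_top'']; exact le_top
      rw [huniv]; exact isClosed_univ
    · exact isClosed_setOf_le_idealOrder_of_isJ2 hreg hJ2 hJ _
  exact hpre ▸ key

/-- **THE DECIDED CELL modulo the costume `BaseStable` only** (PROVED): `BaseStable → WORAllAbs n → WORTopOnlySplit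
n`. [new] [folklore] -/
theorem worTopOnlySplit_of_baseStable (hBS : BaseStable) {n : ℕ} (hn : 1 ≤ n) (hA : WORAllAbs n) : WORTopOnlySplit n :=
  worTopOnlySplit_of_orderUSC orderUSC_holds hBS hn hA

/-- **THE RE-LOCATION modulo the costume only**: `BaseStable → SubfieldContactAbs → E 5 → (E1TopNoAbs ↔
E1TopNonSplit)`. [new] [folklore] -/
theorem e1TopNoAbs_iff_e1TopNonSplit_of_baseStable (hBS : BaseStable) (hSC : SubfieldContactAbs) (h5 : E 5) :
    E1TopNoAbs ↔ E1TopNonSplit :=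
  e1TopNoAbs_iff_e1TopNonSplit_of_orderUSC orderUSC_holds hBS hSC h5

/-- **Summit edge modulo the costume only**: `BaseStable → SubfieldContactAbs → E 5 → E1TopNonSplit → E 1`. [new] [folklore] -/
theorem e_one_of_nonSplit_of_baseStable (hBS : BaseStable) (hSC : SubfieldContactAbs) (h5 : E 5)
    (hR : E1TopNonSplit) : E 1 :=
  e_one_of_nonSplit_of_orderUSC orderUSC_holds hBS hSC h5 hR

end USC

end Summit.ResolutionOfSingularities.ResolutionOfSingularities.Theorems.TwistCutClasses
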